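import Summits.QuantumFields.BalabanUV.T4Continuum.Support.NE3EnergyWeightedShapes
import HarnessLib

/-!
# T⁴ programme, node NE3 — the re-typed root WITH SUP CONTROL, T-E_w♯ (`NE3EnergyWeightedSupShape.NE3EnergyRateWSup`): the η-weighted energy-distance
# shape of the local half with ONE more conjunct inside the `∃(u, Z)` — a geometrically DECAYING sup bound on the direction

NE3 prover lineage P1, gen 20 (cell `pub-balaban`, unit `b2b-balaban-t4-ne3-p1`, row NE3 OWNER).  CONTEXT (skeleton v1.9 §4b, rows
E-SUP and D-CRUDE-w; crew SHAPE `t4/formal/NE3/Statements/E-SUP-SHAPE-v1.md` §0): the crude (D) END in the weighted currency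
(D-CRUDE-w, files `NE3LocalCrudeW{Pair,Rate,End}`) brackets the second-order remainder of the window action with factors `e^α`,
`α = ‖Z‖_∞`, and bond terms `Σ bondSq ≤ 4#Pl·(L^k)²·E_w²` that decay ONLY IF the sup of the direction decays.  The sup is NOT
implied by T-E_w (`NE3EnergyWeightedShapes.NE3EnergyRateW`: in the weighted currency `‖Z‖_∞ ≤ L^k·E_w = O(√g·N²)`, no decay),
and since the pair `(u, Z)` is bound by `∃` INSIDE T-E_w, a sup statement cannot be a separate hypothesis «about the pair».  THIS
FILE types the strengthened root:

* **T-E_w♯** `NE3EnergyRateWSup 𝒞 L N b g C s dom` := VERBATIM `NE3EnergyRateW 𝒞 L N b g C dom` with the extra conjunct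
  `∀ x κ, ‖Z x κ‖ ≤ s·(L⁻¹)^k` (k-free `s ≥ 0`; the crew's E-SUP (D) with `s_k = s·L^{−k}`) — a hypothesis∕target SHAPE of OUR
  repaired frame, asserted for nothing but the flat datum;
* the projection `NE3EnergyRateWSup → NE3EnergyRateW` and the monotonicity in `(C, s)`;
* NON-VACUITY on the flat datum (`u = 1`, `Z = 0`).

Its intended suppliers: (ML_w) ∧ (RES♯) through the chart composition (`NE3EnergyChartLeavesSockets.ne3EnergyRateW_of_chartLeaves`)
for the energy conjunct, and the crew's E-SUP module (`NE3SupControl`: mass + norm-modulus (NM_λ) on the period torus,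
`‖Z‖_∞ ≤ (4Λ + L^k·E_w)∕L^k` at `d = 4`) for the sup conjunct — NONE of them proved here.

HONEST FRAMING.  A SHAPE and two one-line consequences; NOTHING is proved about Bałaban's minimisers; T-E_w♯, T-E_w, (ML_w),
(RES♯), (NM_λ) are hypothesis shapes of ours, none printed as such (printed context for the sup: [Balaban1985Variational] Thm 1 (9)
p. 279, the regularity of the gauge-fixed minimiser — context only, not a hypothesis of any theorem); NE3 NOT proved; spine PROVED
0∕9; finite T⁴ rung (B)+1 — NOT infinite volume, NOT mass gap, NOT `BetaPertH`, NOT Clay.  PLACEMENT: `Summits/QuantumFields/BalabanUV/`.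
HONEST DEPENDENCY (cell page 1): continuum YM on T⁴ ⇐ BetaPertH ∧ nine spine estimates (0/9 proved); BetaPertH ⇐ (D1) ∧ (D4) ∧
CAP+tail; G-an2-4 gates asym, D1 and NE2/3/4.
-/

set_option autoImplicit false

open scoped BigOperators Matrix Matrix.Norms.L2Operator
open Finset

namespace Summit.QuantumFields.BalabanUV.T4Continuum.NE3EnergyWeightedSupShape

open Literature.MathematicalPhysics.QuantumFieldTheory.Balaban1983to89
open B7Prop1Explicit B7Prop2Explicit
open T4AveragingDeficitWall hiding Site Plane Plaq Bond
open T4AveragingDeficitWallBoundary (periodBox)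
open AveragingDeficitPeriodicCounting (IsPeriodicDir)
open MinimalActionSandwich (IsMinimiser)
open MinimalActionRate (Regular)
open MinimalActionWitness (flatCfg flatClass)
open NE3EnergyShapes (residualScale residualScale_nonneg IsUnitarySite IsPeriodicSite gaugeAct_one rescale_bavg_flatCfg)
open NE3EnergyWeightedShapes (energyNormW energyNormW_nonneg energyNormW_zero NE3EnergyRateW)

noncomputable section

variable {d : ℕ} {n : Type*} [Fintype n] [DecidableEq n]

/-! ## §1 The shape T-E_w♯ -/

variable (d) in
/-- **T-E_w♯ — NE3 IN THE η-WEIGHTED ENERGY-DISTANCE READING, WITH A DECAYING SUP BOUND ON THE DIRECTION** (a `Prop`; asserted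
for no class here except the flat one below): VERBATIM `NE3EnergyWeightedShapes.NE3EnergyRateW 𝒞 L N b g C dom` with ONE more
conjunct inside the `∃(u, Z)`: `∀ x κ, ‖Z x κ‖ ≤ s·(L⁻¹)^k` — the sup of the relative direction between the run-A minimiser (gauge
fixed by `u`) and the averaged run-B minimiser decays geometrically at rate `L⁻¹` with a k-free prefactor `s`.  The consumer is
the weighted crude (D) END (`NE3LocalCrudeWEnd`); the sup conjunct's intended discharger is the crew's E-SUP module (mass + norm
modulus on the period torus).  A hypothesis∕target SHAPE of OUR repaired frame (R3). [folklore] -/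
@[folklore]
def NE3EnergyRateWSup (𝒞 : ℕ → Set (Site d → Fin d → (Matrix n n ℂ)ˣ)) (L N : ℕ) (b g C s : ℝ)
    (dom : Set (Site d → Fin d → (Matrix n n ℂ)ˣ)) : Prop :=
  ∀ k : ℕ, 1 ≤ k → ∀ V ∈ dom, ∀ UA UB : Site d → Fin d → (Matrix n n ℂ)ˣ,
    IsMinimiser d 𝒞 L N k V UA → IsMinimiser d 𝒞 L N (k + 1) V UB → Regular d L N b g (k + 1) UB →
      ∃ (u : Site d → (Matrix n n ℂ)ˣ) (Z : Site d → Fin d → Matrix n n ℂ),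
        IsUnitarySite u ∧ IsPeriodicSite u ((N * L ^ k : ℕ) : ℤ) ∧
        IsSkewDir Z ∧ IsPeriodicDir Z ((N * L ^ k : ℕ) : ℤ) ∧
        gaugeAct u UA = vary (rescale L (bavg L UB)) Z 1 ∧
        energyNormW L k (rescale L (bavg L UB)) Z (periodBox (N * L ^ k)) ≤ C * residualScale d L N b g k ∧
        ∀ (x : Site d) (κ : Fin d), ‖Z x κ‖ ≤ s * ((L : ℝ)⁻¹) ^ k

/-! ## §2 Projection and monotonicity -/

/-- **T-E_w♯ ⇒ T-E_w**: dropping the sup conjunct recovers the re-typed root verbatim. [folklore] -/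
theorem ne3EnergyRateW_of_sup {𝒞 : ℕ → Set (Site d → Fin d → (Matrix n n ℂ)ˣ)} {L N : ℕ} {b g C s : ℝ}
    {dom : Set (Site d → Fin d → (Matrix n n ℂ)ˣ)} (h : NE3EnergyRateWSup d 𝒞 L N b g C s dom) :
    NE3EnergyRateW d 𝒞 L N b g C dom := by
  intro k hk V hV UA UB hA hB hreg
  obtain ⟨u, Z, hu, huP, hZ, hZP, hrep, hE, -⟩ := h k hk V hV UA UB hA hB hreg
  exact ⟨u, Z, hu, huP, hZ, hZP, hrep, hE⟩

/-- T-E_w♯ is monotone in the two constants: `C ≤ C′`, `s ≤ s′` (the residual scale is non-negative; `L⁻¹ ≥ 0` needs no sign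
hypothesis since `((L:ℝ)⁻¹)^k ≥ 0` for a natural `L`). [folklore] -/
theorem NE3EnergyRateWSup.mono {𝒞 : ℕ → Set (Site d → Fin d → (Matrix n n ℂ)ˣ)} {L N : ℕ} {b g C C' s s' : ℝ}
    {dom : Set (Site d → Fin d → (Matrix n n ℂ)ˣ)} (h : NE3EnergyRateWSup d 𝒞 L N b g C s dom) (hC : C ≤ C')
    (hs : s ≤ s') : NE3EnergyRateWSup d 𝒞 L N b g C' s' dom := by
  intro k hk V hV UA UB hA hB hreg
  obtain ⟨u, Z, hu, huP, hZ, hZP, hrep, hE, hsup⟩ := h k hk V hV UA UB hA hB hreg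
  have hθ : 0 ≤ ((L : ℝ)⁻¹) ^ k := pow_nonneg (inv_nonneg.mpr (Nat.cast_nonneg L)) k
  refine ⟨u, Z, hu, huP, hZ, hZP, hrep, hE.trans ?_, fun x κ => (hsup x κ).trans ?_⟩
  · exact mul_le_mul_of_nonneg_right hC (residualScale_nonneg d L N b g k)
  · exact mul_le_mul_of_nonneg_right hs hθ

/-! ## §3 Non-vacuity on the flat datum -/

/-- NON-VACUITY: in the flat class with the flat datum T-E_w♯ holds for every `C, s ≥ 0` (both minimisers flat, `u = 1`,
`Z = 0`). [folklore] -/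
theorem ne3EnergyRateWSup_flat [Nonempty n] (L N : ℕ) (b g : ℝ) {C s : ℝ} (hC : 0 ≤ C) (hs : 0 ≤ s) :
    NE3EnergyRateWSup d (flatClass (n := n)) L N b g C s {flatCfg} := by
  intro k _ V _ UA UB hA hB _
  have hUA : UA = flatCfg := by simpa [flatClass, MinimalActionSandwich.admissible] using hA.mem.1
  have hUB : UB = flatCfg := by simpa [flatClass, MinimalActionSandwich.admissible] using hB.mem.1
  refine ⟨fun _ => 1, fun (_ : Site d) (_ : Fin d) => (0 : Matrix n n ℂ), fun _ => (unitaryUnits _).one_mem,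
    fun _ _ => rfl, fun _ _ => (skewAdjoint _).zero_mem, fun _ _ _ => rfl, ?_, ?_, ?_⟩
  · rw [hUA, hUB, rescale_bavg_flatCfg, gaugeAct_one, vary_zero_dir]
  · rw [energyNormW_zero]
    exact mul_nonneg hC (residualScale_nonneg d L N b g k)
  · intro x κ
    rw [norm_zero]
    exact mul_nonneg hs (pow_nonneg (inv_nonneg.mpr (Nat.cast_nonneg L)) k)

end

end Summit.QuantumFields.BalabanUV.T4Continuum.NE3EnergyWeightedSupShape
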